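import Mathlib
import Summits.NavierStokesRegularity.NavierStokesRegularity.Theorems.SubOnsagerCeilingVirtualFloorKernelFace
import HarnessLib

/-!
# Kernel face checks for the Ω-COUPLED four-window format (six-variable slacks, coupled field)
(helper file for crux stmt-NavierStokesRegularity-27057 `SubOnsagerCeiling.ForwardTailCeilingKP`, `--supports … --as helper`;
LEAD SOC g9, line «kp-shell-barrier»; companion of `SubOnsagerCeilingVirtualFloorKernelFace` (p687184))

`SubOnsagerCeilingVirtualFloorKernelFace` turns the face conditions of the virtual-floor certificate lemmas into kernel
computations (kd-tree box certificates of the tree's validated-numerics layer, S-procedure slacks in the four window coordinates).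
The format LEAD g8 recommends for the first rung below `b = 25/16` is the Ω-COUPLED bounded four-window scheme
`VirtualFloor.window4_le_of_coupledCertB` (p680792) / `chain_le_of_coupledCertB` (p681020), whose per-face hypotheses carry TWO
more variables — the feed `v` and the drain `z`, constrained by the facets of the neighbour windows `(v,x₀,x₁,x₂)` and
`(x₁,x₂,x₃,z)` and by `v, z ≤ c` — and whose field has the last component `L³(x₂² − p x₃ z)`. This file supplies exactly that:

* `LinSlackVZ` / `linSlackVZExpr` — linear slack terms in the six variables (`v` = slot 4, `z` = slot 8), `faceExprC`, and the
  soundness theorems `eval_lt_zero_of_kdCheckC` (strict, inertial) / `eval_nonneg_of_kdCheckC` (damping sign);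
* `inertialExprC` (the coupled field, `v` entering as `v·v`) and `floFaceExprC2` (the top cubic floor against the coupled field),
  with their real semantics.

Emission pattern per face = the worked example of the companion file with `eval_lt_zero_of_kdCheckC` in place of
`eval_lt_zero_of_kdCheck`. HONEST FRAMING: plumbing towards a MODEL-lattice rung (crux `ForwardTailCeilingKP`, route
SubOnsagerCeiling, TL-M2Break); certifies no design by itself; nothing here bears on Navier–Stokes regularity; 27057 stays OPEN.
[cite: Moore1966, Theorem 3.1, §4.4] [cite: BarbatoMorandinRomito2011, §2 Lemma 2.1]
-/

-- the sub-problem namespace `NavierStokesRegularity.NavierStokesRegularity` is the tree's layout (D-0017)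
set_option linter.dupNamespace false

namespace Summit.NavierStokesRegularity.NavierStokesRegularity.Theorems.VirtualFloor.KernelFace

open Literature.Analysis.ValidatedNumerics


/-- A linear slack term in the SIX variables of a coupled face condition:
`λ · (d − bv·v − b₀E₀ − b₁E₁ − b₂E₂ − b₃E₃ − bz·z)` with the feed `v` in slot `4` and the drain `z` in slot `8` (the facets of
the neighbour windows `(v,x₀,x₁,x₂)` and `(x₁,x₂,x₃,z)` of `window4_le_of_coupledCertB`, and the bounds `v, z ≤ c`). [folklore] -/
structure LinSlackVZ where
  /-- multiplier (must be `≥ 0`) -/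
  lam : ℚ
  /-- coefficient of the feed `v` (slot 4) -/
  bv : ℚ
  /-- coefficient of `E₀` -/
  b0 : ℚ
  /-- coefficient of `E₁` -/
  b1 : ℚ
  /-- coefficient of `E₂` -/
  b2 : ℚ
  /-- coefficient of `E₃` -/
  b3 : ℚ
  /-- coefficient of the drain `z` (slot 8) -/
  bz : ℚ
  /-- level -/
  d : ℚ
  deriving DecidableEq

/-- The expression of one six-variable linear slack term. [folklore] -/
def LinSlackVZ.expr (s : LinSlackVZ) (E0 E1 E2 E3 : ArithExpr) : ArithExpr :=
  .mul (.const s.lam) (.sub (.sub (.sub (.sub (.sub (.sub (.const s.d) (.mul (.const s.bv) (.var 4)))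
    (.mul (.const s.b0) E0)) (.mul (.const s.b1) E1)) (.mul (.const s.b2) E2)) (.mul (.const s.b3) E3))
    (.mul (.const s.bz) (.var 8)))

/-- Real semantics of a six-variable linear slack term. [folklore] -/
theorem LinSlackVZ.eval_expr (s : LinSlackVZ) (E0 E1 E2 E3 : ArithExpr) (x : ℕ → ℝ) :
    (s.expr E0 E1 E2 E3).eval x =
      (s.lam : ℝ) * ((s.d : ℝ) - s.bv * x 4 - s.b0 * E0.eval x - s.b1 * E1.eval x - s.b2 * E2.eval x -
        s.b3 * E3.eval x - s.bz * x 8) := by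
  simp [LinSlackVZ.expr, ArithExpr.eval]

/-- Sum of the six-variable linear slack expressions of a list. [folklore] -/
def linSlackVZExpr (E0 E1 E2 E3 : ArithExpr) : List LinSlackVZ → ArithExpr
  | [] => .const 0
  | s :: l => .add (s.expr E0 E1 E2 E3) (linSlackVZExpr E0 E1 E2 E3 l)

/-- The six-variable slack sum is non-negative where every weight and every slack is non-negative. [folklore] -/
theorem eval_linSlackVZExpr_nonneg (E0 E1 E2 E3 : ArithExpr) (x : ℕ → ℝ) :
    ∀ l : List LinSlackVZ, (∀ s ∈ l, 0 ≤ s.lam) →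
      (∀ s ∈ l, 0 ≤ (s.d : ℝ) - s.bv * x 4 - s.b0 * E0.eval x - s.b1 * E1.eval x - s.b2 * E2.eval x -
        s.b3 * E3.eval x - s.bz * x 8) →
      0 ≤ (linSlackVZExpr E0 E1 E2 E3 l).eval x
  | [], _, _ => by simp [linSlackVZExpr]
  | s :: l, hl, hs => by
    have h1 : 0 ≤ (s.expr E0 E1 E2 E3).eval x := by
      rw [LinSlackVZ.eval_expr]
      exact mul_nonneg (by exact_mod_cast hl s (by simp)) (hs s (by simp))
    have h2 := eval_linSlackVZExpr_nonneg E0 E1 E2 E3 x l (fun s' hs' => hl s' (by simp [hs']))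
      (fun s' hs' => hs s' (by simp [hs']))
    simp only [linSlackVZExpr, ArithExpr.eval]
    linarith

/-- The checked expression of a COUPLED face: `e + Σ six-variable linear slacks + Σ floor slacks`. [folklore] -/
def faceExprC (e : ArithExpr) (E0 E1 E2 E3 : ArithExpr) (ls : List LinSlackVZ) (fs : List FloSlack) : ArithExpr :=
  .add (.add e (linSlackVZExpr E0 E1 E2 E3 ls)) (floSlackExpr E0 E1 E2 E3 fs)

/-- **Strict face condition from a kd-tree kernel certificate, coupled form** (slacks in `v, x₀…x₃, z`): if the check
certifies `e + Σ λ·g ≤ −δ < 0` on the box, then `e < 0` wherever the slacks are `≥ 0`. [cite: Moore1966, Theorem 3.1, §4.4] -/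
theorem eval_lt_zero_of_kdCheckC {e E0 E1 E2 E3 : ArithExpr} {ls : List LinSlackVZ} {fs : List FloSlack}
    {B : Box} {t : KdCert ℕ} {δ : ℚ} (hδ : 0 < δ)
    (hcheck : t.check (exprLeOn (faceExprC e E0 E1 E2 E3 ls fs) (-δ)) B = true)
    (hls : ∀ s ∈ ls, 0 ≤ s.lam) (hfs : ∀ s ∈ fs, 0 ≤ s.lam)
    (x : ℕ → ℝ) (hx : B.mem x)
    (hlin : ∀ s ∈ ls, 0 ≤ (s.d : ℝ) - s.bv * x 4 - s.b0 * E0.eval x - s.b1 * E1.eval x - s.b2 * E2.eval x -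
      s.b3 * E3.eval x - s.bz * x 8)
    (hflo : ∀ s ∈ fs, 0 ≤ (coordE E0 E1 E2 E3 (s.i + 1)).eval x - s.κ * (coordE E0 E1 E2 E3 s.i).eval x ^ 3 + s.ε) :
    e.eval x < 0 := by
  have h := eval_le_of_kdCheck hcheck x hx
  have h1 := eval_linSlackVZExpr_nonneg E0 E1 E2 E3 x ls hls hlin
  have h2 := eval_floSlackExpr_nonneg E0 E1 E2 E3 x fs hfs hflo
  simp only [faceExprC, ArithExpr.eval] at h
  have hδ' : (0 : ℝ) < δ := by exact_mod_cast hδ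
  have : ((-δ : ℚ) : ℝ) = -(δ : ℝ) := by push_cast; ring
  rw [this] at h
  linarith

/-- **Non-strict coupled form (`≥ 0`)** for damping-sign conditions. [cite: Moore1966, Theorem 3.1, §4.4] -/
theorem eval_nonneg_of_kdCheckC {e E0 E1 E2 E3 : ArithExpr} {ls : List LinSlackVZ} {fs : List FloSlack}
    {B : Box} {t : KdCert ℕ}
    (hcheck : t.check (exprLeOn (faceExprC (.neg e) E0 E1 E2 E3 ls fs) 0) B = true)
    (hls : ∀ s ∈ ls, 0 ≤ s.lam) (hfs : ∀ s ∈ fs, 0 ≤ s.lam)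
    (x : ℕ → ℝ) (hx : B.mem x)
    (hlin : ∀ s ∈ ls, 0 ≤ (s.d : ℝ) - s.bv * x 4 - s.b0 * E0.eval x - s.b1 * E1.eval x - s.b2 * E2.eval x -
      s.b3 * E3.eval x - s.bz * x 8)
    (hflo : ∀ s ∈ fs, 0 ≤ (coordE E0 E1 E2 E3 (s.i + 1)).eval x - s.κ * (coordE E0 E1 E2 E3 s.i).eval x ^ 3 + s.ε) :
    0 ≤ e.eval x := by
  have h := eval_le_of_kdCheck hcheck x hx
  have h1 := eval_linSlackVZExpr_nonneg E0 E1 E2 E3 x ls hls hlin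
  have h2 := eval_floSlackExpr_nonneg E0 E1 E2 E3 x fs hfs hflo
  simp only [faceExprC, ArithExpr.eval] at h
  push_cast at h
  linarith

/-- The INERTIAL form of a linear facet in the Ω-COUPLED four-window scheme (`window4_le_of_coupledCertB`): the field is
`(v² − p x₀x₁, L(x₀² − p x₁x₂), L²(x₁² − p x₂x₃), L³(x₂² − p x₃ z))` with the feed `v` in slot `4` (entering as `v·v`) and
the drain `z` in slot `8`. [cite: BarbatoMorandinRomito2011, §2 Lemma 2.1] -/
def inertialExprC (a0 a1 a2 a3 : ℚ) (E0 E1 E2 E3 : ArithExpr) : ArithExpr :=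
  .add (.add (.add
    (.mul (.const a0) (.sub (.mul (.var 4) (.var 4)) (.mul (.mul (.var 6) E0) E1)))
    (.mul (.const a1) (.mul (.var 5) (.sub (.mul E0 E0) (.mul (.mul (.var 6) E1) E2)))))
    (.mul (.const a2) (.mul (.mul (.var 5) (.var 5)) (.sub (.mul E1 E1) (.mul (.mul (.var 6) E2) E3)))))
    (.mul (.const a3) (.mul (.mul (.mul (.var 5) (.var 5)) (.var 5)) (.sub (.mul E2 E2) (.mul (.mul (.var 6) E3) (.var 8)))))

/-- Real semantics of `inertialExprC`. [folklore] -/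
theorem eval_inertialExprC (a0 a1 a2 a3 : ℚ) (E0 E1 E2 E3 : ArithExpr) (x : ℕ → ℝ) :
    (inertialExprC a0 a1 a2 a3 E0 E1 E2 E3).eval x =
      (a0 : ℝ) * (x 4 ^ 2 - x 6 * E0.eval x * E1.eval x) + a1 * (x 5 * (E0.eval x ^ 2 - x 6 * E1.eval x * E2.eval x)) +
        a2 * (x 5 ^ 2 * (E1.eval x ^ 2 - x 6 * E2.eval x * E3.eval x)) +
        a3 * (x 5 ^ 3 * (E2.eval x ^ 2 - x 6 * E3.eval x * x 8)) := by
  simp [inertialExprC, ArithExpr.eval]; ring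

/-- The INERTIAL form of the top cubic floor `κ x₂³ − ε ≤ x₃` in the coupled scheme (`hFlo 2` of `window4_le_of_coupledCertB`):
`3κ x₂²·L²(x₁² − p x₂x₃) − L³(x₂² − p x₃ z)`; the floors `i = 0, 1` are `floFaceExpr 0/1` unchanged (with `V = v·v`
substituted by the user: take `floFaceExpr` with slot 4 holding `v²`, or use this file's generic theorem with an explicit
expression). [cite: BarbatoMorandinRomito2011, §2 Lemma 2.1] -/
def floFaceExprC2 (κ : ℚ) (_E0 E1 E2 E3 : ArithExpr) : ArithExpr :=
  .sub (.mul (.mul (.const (3 * κ)) (.mul E2 E2)) (.mul (.mul (.var 5) (.var 5)) (.sub (.mul E1 E1) (.mul (.mul (.var 6) E2) E3))))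
    (.mul (.mul (.mul (.var 5) (.var 5)) (.var 5)) (.sub (.mul E2 E2) (.mul (.mul (.var 6) E3) (.var 8))))

/-- Real semantics of `floFaceExprC2`. [folklore] -/
theorem eval_floFaceExprC2 (κ : ℚ) (E0 E1 E2 E3 : ArithExpr) (x : ℕ → ℝ) :
    (floFaceExprC2 κ E0 E1 E2 E3).eval x =
      3 * (κ : ℝ) * E2.eval x ^ 2 * (x 5 ^ 2 * (E1.eval x ^ 2 - x 6 * E2.eval x * E3.eval x)) -
        x 5 ^ 3 * (E2.eval x ^ 2 - x 6 * E3.eval x * x 8) := by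
  simp [floFaceExprC2, ArithExpr.eval]; ring


end Summit.NavierStokesRegularity.NavierStokesRegularity.Theorems.VirtualFloor.KernelFace
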